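import Summits.HodgeConjecture.HodgeConjecture.Theorems.Ring2WeilCoverageCyclotomicUnitSignatures
import HarnessLib

/-!
# Weil-type family coverage — THEOREM L (ii) from sign-vector witnesses for an ARBITRARY family of real units with a
# decidable sign law (part 14 abstracted): even subsets of CM type sets are patterns, hence `hU'` and the census's
# YES verdicts, at every level `n`

research route conditional on HC_CM; not a corollary; Q11.4-sentence-2 already refuted in dim ≥ 3.

Ring 2, WEIL-TYPE FAMILY-COVERAGE CENSUS (`HOME/WEIL-FAMILY-COVERAGE.md` `## b01`, blocks b01.23 (A)/(D) and b01.28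
THEOREM L, owner ring2-b01), part 21 of the `Ring2WeilCoverage*` series.  Part 14 (`…CyclotomicUnitSignatures`)
proved «witness property `(W)` ⟹ every even sign pattern is a real unit's ⟹ YES verdicts» for the specific family
`ζ^h(1 − ζ^a)(1 − ζ^b)` of part 13, which is EMPTY at prime-power levels (census level `M = 32`).  This file is the
same argument for an ABSTRACT family: an index type `α`, a decidable sign law `σ : α → ℤ/n → Prop`, an admissibility
predicate `adm`, and the FAMILY PROPERTY

  `hfam`: for every finite admissible `A ⊆ α` and sign `ε` there is a unit `u ∈ 𝓞 K` fixed by `ρ` whose sign under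
  an embedding `φ` reading the unit residue `t` (`φ ζ = 𝐞(t)`) is `Odd(#{x ∈ A : σ x t} + [ε])`

(part 13's `exists_units_coe_eq` + `re_embedding_prod_neg_iff` for the product family; part 20's
`exists_units_coe_eq_geomSum` + `re_embedding_prod_geomSum_neg_iff` for the geometric-sum family
`ζ^c(1 + ζ + ⋯ + ζ^{a−1})`, which exists at every level):

* §1 `patF_symmDiff` (patterns add under `∆`), `exists_pattern_pair_family`, **`exists_pattern_of_witnesses_family`**:
  under `(W)` for `σ`, every even subset `J` of a CM type set `T` is the pattern of an admissible signed product.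
* §2 **`exists_units_sign_eq_family`** (`hfam` + `(W)` ⟹ part 7's `hU'` for every CM type `Φ`) and
  **`exists_principal_of_family`** (`hfam` + `(W)` + `Φ` balanced for a CM type set `N_K` with `n₋` even ⟹
  `∃ ζ′, ζ′^ρ = −ζ′ ∧ (∀ φ ∈ Φ, Im φ(ζ′) > 0) ∧ CMTypeLattice.IsOfType 1 ζ′ ⊤`).

HONEST FRAMING: `hfam` and `(W)` are hypotheses here (discharged per family and level in parts 13/20 and 15–19/22);
statements about Shimura's divisors of principal type on the principal CM torus `ℂ^Φ/Φ(ℤ[ζₙ])`; nothing about Hodge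
classes, `W_K`, general members or HC; `HC_CM` is used nowhere.  No `def`, no named fact, no `sorry`.

References: [cite: Shimura1998, §14.3 Prop. 4–5, pp. 103–104]; census b01.23 (A) / b01.28 THEOREM L (seat-derived).
-/

noncomputable section

open Polynomial NumberField Complex Finset
open scoped Real nonZeroDivisors symmDiff

namespace Summit.HodgeConjecture.Ring2WeilCoverage.CyclotomicUnitSignaturesFamily

open Literature.AlgebraicGeometry.Motives (CMType)
open Literature.AlgebraicGeometry.HodgeTheory (IsCMTypeSet)
open Literature.AlgebraicGeometry.ComplexMultiplication.CyclotomicCMType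
  (exists_apply_eq_toCircle embedding_eq_of_apply_eq isCMTypeSet_residueFilter)
open Literature.NumberTheory.ComplexMultiplication
open Summit.HodgeConjecture.Ring2WeilCoverage.CyclotomicUnitSignatures (card_filter_symmDiff_add)
open Summit.HodgeConjecture.Ring2WeilCoverage.CyclotomicPrincipalObstruction (exists_principal_of_even)

variable {n : ℕ} [NeZero n] {α : Type} [DecidableEq α] (σ : α → ZMod n → Prop) [∀ x t, Decidable (σ x t)]
  (adm : α → Prop)

/-- `𝐞(t) = exp(2πi t/n) ∈ ℂ` (`ZMod.toCircle`). -/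
local notation3 (prettyPrint := false) "𝐞 " t:max => ((ZMod.toCircle t : Circle) : ℂ)

/-- the sign pattern of the signed product `(A, ε)` at `t` for the sign law `σ`: `#{x ∈ A : σ x t} + [ε]` is odd. -/
local notation3 (prettyPrint := false) "patF " A:max ε:max t:max =>
  Odd ((Finset.filter (fun x => σ x t) A).card + (if (ε : Bool) then 1 else 0))

/-- the witness property `(W)` of the level `n` for the family (`σ`, `adm`). -/
local notation3 (prettyPrint := false) "WitnessPropertyF" =>
  (∀ s : ZMod n, s.val.Coprime n → s ≠ 1 → s ≠ -1 →
    ∃ A : Finset α, ∃ ε : Bool, (∀ x ∈ A, adm x) ∧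
      ∀ t : ZMod n, t.val.Coprime n → (patF A ε t ↔ (t = 1 ∨ t = -1 ∨ t = s ∨ t = -s)))

/-! ### §1 Patterns add; even subsets of a CM type set are patterns -/

omit [NeZero n] in
/-- **Patterns ADD**: the pattern of `(A ∆ B, ε ⊻ ε′)` at `t` is the XOR of the patterns of `(A, ε)` and `(B, ε′)`.
research route conditional on HC_CM; not a corollary; Q11.4-sentence-2 already refuted in dim ≥ 3. [folklore] -/
theorem patF_symmDiff (A B : Finset α) (ε ε' : Bool) (t : ZMod n) :
    patF (A ∆ B) (xor ε ε') t ↔ ((patF A ε t ∧ ¬ patF B ε' t) ∨ (patF B ε' t ∧ ¬ patF A ε t)) := by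
  have key := card_filter_symmDiff_add A B (fun x => σ x t)
  simp only [Nat.odd_iff]
  cases ε <;> cases ε' <;>
    simp only [Bool.false_xor, Bool.true_xor, Bool.not_false, Bool.not_true, Bool.false_eq_true, if_true,
      if_false] <;> omega

omit [NeZero n] [DecidableEq α] in
/-- Admissibility passes to symmetric differences.
research route conditional on HC_CM; not a corollary; Q11.4-sentence-2 already refuted in dim ≥ 3. [folklore] -/
theorem admF_symmDiff [DecidableEq α] {A B : Finset α} (hA : ∀ x ∈ A, adm x) (hB : ∀ x ∈ B, adm x) :
    ∀ x ∈ A ∆ B, adm x := by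
  intro x hx
  rw [Finset.mem_symmDiff] at hx
  rcases hx with ⟨h, -⟩ | ⟨h, -⟩
  · exact hA x h
  · exact hB x h

omit [NeZero n] in
/-- **Pairs are patterns**: under `(W)`, for unit residues `t₁, t₂` with `t₂ ≠ t₁`, `t₂ ≠ −t₁` there is an
admissible signed product negative exactly at `{t₁, −t₁, t₂, −t₂}` (if one of them is `±1` the other's witness
serves; otherwise the symmetric difference of the two witnesses).
research route conditional on HC_CM; not a corollary; Q11.4-sentence-2 already refuted in dim ≥ 3. [folklore] -/
theorem exists_pattern_pair_family (hW : WitnessPropertyF) {t₁ t₂ : ZMod n} (h₁ : t₁.val.Coprime n)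
    (h₂ : t₂.val.Coprime n) (hne : t₂ ≠ t₁) (hne' : t₂ ≠ -t₁) :
    ∃ A : Finset α, ∃ ε : Bool, (∀ x ∈ A, adm x) ∧
      ∀ t : ZMod n, t.val.Coprime n → (patF A ε t ↔ (t = t₁ ∨ t = -t₁ ∨ t = t₂ ∨ t = -t₂)) := by
  have hne'' : t₁ ≠ -t₂ := fun h => hne' (by rw [h, neg_neg])
  by_cases h1 : t₁ = 1 ∨ t₁ = -1
  · have h2a : t₂ ≠ 1 := by
      rcases h1 with rfl | rfl
      · exact hne
      · rwa [neg_neg] at hne'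
    have h2b : t₂ ≠ -1 := by
      rcases h1 with rfl | rfl
      · exact hne'
      · exact hne
    obtain ⟨A, ε, hA, hP⟩ := hW t₂ h₂ h2a h2b
    refine ⟨A, ε, hA, fun t ht => ?_⟩
    rw [hP t ht]
    rcases h1 with rfl | rfl
    · exact Iff.rfl
    · rw [neg_neg]; tauto
  · push Not at h1
    by_cases h2 : t₂ = 1 ∨ t₂ = -1
    · obtain ⟨A, ε, hA, hP⟩ := hW t₁ h₁ h1.1 h1.2
      refine ⟨A, ε, hA, fun t ht => ?_⟩
      rw [hP t ht]
      rcases h2 with rfl | rfl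
      · tauto
      · rw [neg_neg]; tauto
    · push Not at h2
      obtain ⟨A₁, ε₁, hA₁, hP₁⟩ := hW t₁ h₁ h1.1 h1.2
      obtain ⟨A₂, ε₂, hA₂, hP₂⟩ := hW t₂ h₂ h2.1 h2.2
      refine ⟨A₁ ∆ A₂, xor ε₁ ε₂, admF_symmDiff adm hA₁ hA₂, fun t ht => ?_⟩
      rw [patF_symmDiff σ, hP₁ t ht, hP₂ t ht]
      obtain ⟨h11, h12⟩ := h1
      obtain ⟨h21, h22⟩ := h2
      have e1 : -t₁ ≠ 1 := fun h => h12 (by rw [← h, neg_neg])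
      have e2 : -t₁ ≠ -1 := fun h => h11 (neg_injective h)
      have e3 : -t₂ ≠ 1 := fun h => h22 (by rw [← h, neg_neg])
      have e4 : -t₂ ≠ -1 := fun h => h21 (neg_injective h)
      have e5 : -t₁ ≠ t₂ := fun h => hne' h.symm
      have e6 : -t₁ ≠ -t₂ := fun h => hne (neg_injective h).symm
      constructor
      · rintro (⟨ha, hb⟩ | ⟨ha, hb⟩) <;> tauto
      · rintro (rfl | rfl | rfl | rfl)
        · left
          exact ⟨by tauto, fun h => by rcases h with h | h | h | h; exacts [h11 h, h12 h, hne h.symm, hne'' h]⟩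
        · left
          exact ⟨by tauto, fun h => by rcases h with h | h | h | h; exacts [e1 h, e2 h, e5 h, e6 h]⟩
        · right
          exact ⟨by tauto, fun h => by rcases h with h | h | h | h; exacts [h21 h, h22 h, hne h, hne' h]⟩
        · right
          exact ⟨by tauto, fun h => by
            rcases h with h | h | h | h
            exacts [e3 h, e4 h, hne'' h.symm, hne (neg_injective h)]⟩

/-- **EVEN SUBSETS OF A CM TYPE SET ARE PATTERNS**: under `(W)`, for every CM type set `T` of `(ℤ/n)ˣ` and every
`J ⊆ T` with `|J|` even there is an admissible signed product `(A, ε)` with `patF A ε t ↔ (t ∈ J ∨ −t ∈ J)` for all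
unit residues `t` — the sign vector «negative exactly at the places under `J`».  Induction on `|J|`: peel a pair
`t₁, t₂ ∈ J` (§1 `exists_pattern_pair`; `t₂ ≠ −t₁` because `T ∌ −t₁`), add the patterns (`pat_symmDiff`); the
pieces are disjoint because `J ⊆ T` and `T` contains no opposite pair.
research route conditional on HC_CM; not a corollary; Q11.4-sentence-2 already refuted in dim ≥ 3. [folklore] -/
theorem exists_pattern_of_witnesses_family (hW : WitnessPropertyF) {T : Finset (ZMod n)} (hT : IsCMTypeSet n T)
    (J : Finset (ZMod n)) (hJT : J ⊆ T) (hJ : Even J.card) :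
    ∃ A : Finset α, ∃ ε : Bool, (∀ x ∈ A, adm x) ∧
      ∀ t : ZMod n, t.val.Coprime n → (patF A ε t ↔ (t ∈ J ∨ -t ∈ J)) := by
  classical
  suffices hk : ∀ k : ℕ, ∀ J : Finset (ZMod n), J.card = k → J ⊆ T → Even k →
      ∃ A : Finset α, ∃ ε : Bool, (∀ x ∈ A, adm x) ∧
        ∀ t : ZMod n, t.val.Coprime n → (patF A ε t ↔ (t ∈ J ∨ -t ∈ J)) from hk _ J rfl hJT hJ
  intro k
  induction k using Nat.strong_induction_on with
  | _ k ih =>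
    intro J hJk hJT hk
    obtain ⟨j, hj⟩ := hk
    rcases j with _ | j
    · -- `J = ∅`
      have hJ0 : J = ∅ := Finset.card_eq_zero.mp (by omega)
      refine ⟨∅, false, fun x hx => absurd hx (Finset.notMem_empty x), fun t _ => ?_⟩
      subst hJ0
      simp
    · -- peel a pair
      have hJne : J.Nonempty := Finset.card_pos.mp (by omega)
      obtain ⟨t₁, ht₁⟩ := hJne
      have hJ1 : (J.erase t₁).card = k - 1 := by rw [Finset.card_erase_of_mem ht₁, hJk]
      have hJ1ne : (J.erase t₁).Nonempty := Finset.card_pos.mp (by omega)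
      obtain ⟨t₂, ht₂⟩ := hJ1ne
      obtain ⟨ht₂₁, ht₂J⟩ := Finset.mem_erase.mp ht₂
      set J' := (J.erase t₁).erase t₂ with hJ'
      have hJ'card : J'.card = k - 2 := by rw [hJ', Finset.card_erase_of_mem ht₂, hJ1]; omega
      have hJ'T : J' ⊆ T := fun t ht =>
        hJT (Finset.mem_of_mem_erase (Finset.mem_of_mem_erase ht))
      obtain ⟨A', ε', hA', hP'⟩ := ih (k - 2) (by omega) J' hJ'card hJ'T ⟨j, by omega⟩
      have hu₁ : t₁.val.Coprime n := hT.1 t₁ (hJT ht₁)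
      have hu₂ : t₂.val.Coprime n := hT.1 t₂ (hJT ht₂J)
      have hnT₁ : -t₁ ∉ T := (hT.2 t₁ hu₁).mp (hJT ht₁)
      have hnT₂ : -t₂ ∉ T := (hT.2 t₂ hu₂).mp (hJT ht₂J)
      have hne' : t₂ ≠ -t₁ := fun h => hnT₁ (h ▸ hJT ht₂J)
      obtain ⟨A₂, ε₂, hA₂, hP₂⟩ := exists_pattern_pair_family σ adm hW hu₁ hu₂ ht₂₁ hne'
      refine ⟨A' ∆ A₂, xor ε' ε₂, admF_symmDiff adm hA' hA₂, fun t ht => ?_⟩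
      rw [patF_symmDiff σ, hP' t ht, hP₂ t ht]
      -- bookkeeping: `J = J' ⊔ {t₁, t₂}`, and `J' ⊆ T` meets no `±t₁, ±t₂`
      have m1 : t₁ ∉ J' := by rw [hJ']; simp
      have m2 : t₂ ∉ J' := by rw [hJ']; simp
      have m3 : -t₁ ∉ J' := fun h => hnT₁ (hJ'T h)
      have m4 : -t₂ ∉ J' := fun h => hnT₂ (hJ'T h)
      have hmem : ∀ s : ZMod n, s ∈ J ↔ (s ∈ J' ∨ s = t₁ ∨ s = t₂) := fun s => by
        rw [hJ', Finset.mem_erase, Finset.mem_erase]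
        constructor
        · intro hs
          by_cases e1 : s = t₁
          · exact Or.inr (Or.inl e1)
          · by_cases e2 : s = t₂
            · exact Or.inr (Or.inr e2)
            · exact Or.inl ⟨e2, e1, hs⟩
        · rintro (⟨-, -, hs⟩ | rfl | rfl)
          exacts [hs, ht₁, ht₂J]
      have hdis : (t ∈ J' ∨ -t ∈ J') → ¬ (t = t₁ ∨ t = -t₁ ∨ t = t₂ ∨ t = -t₂) := by
        rintro (hX | hX) hP
        · rcases hP with rfl | rfl | rfl | rfl
          exacts [m1 hX, m3 hX, m2 hX, m4 hX]
        · rcases hP with rfl | rfl | rfl | rfl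
          · exact m3 hX
          · rw [neg_neg] at hX; exact m1 hX
          · exact m4 hX
          · rw [neg_neg] at hX; exact m2 hX
      have hY : (t ∈ J ∨ -t ∈ J) ↔ ((t ∈ J' ∨ -t ∈ J') ∨ (t = t₁ ∨ t = -t₁ ∨ t = t₂ ∨ t = -t₂)) := by
        rw [hmem t, hmem (-t), neg_eq_iff_eq_neg (a := t) (b := t₁), neg_eq_iff_eq_neg (a := t) (b := t₂)]
        tauto
      rw [hY]
      constructor
      · rintro (⟨hX, -⟩ | ⟨hP, -⟩)
        exacts [Or.inl hX, Or.inr hP]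
      · rintro (hX | hP)
        · exact Or.inl ⟨hX, hdis hX⟩
        · by_cases hX : t ∈ J' ∨ -t ∈ J'
          · exact Or.inl ⟨hX, hdis hX⟩
          · exact Or.inr ⟨hP, hX⟩


/-! ### §2 THEOREM L (ii) and the census's YES verdicts from a unit family with the witness property -/

variable {K : Type} [Field K] [NumberField K] {ζ : K}

/-- the FAMILY PROPERTY: admissible signed products are real units of `𝓞 K` with the sign law `σ`. -/
local notation3 (prettyPrint := false) "FamilyProperty" =>
  (∀ A : Finset α, (∀ x ∈ A, adm x) → ∀ ε : Bool,
    ∃ u : (𝓞 K)ˣ, IsCMField.complexConj K ((u : 𝓞 K) : K) = ((u : 𝓞 K) : K) ∧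
      ∀ (φ : K →+* ℂ) (t : ZMod n), φ ζ = 𝐞 t → t.val.Coprime n →
        (((φ ((u : 𝓞 K) : K)).re < 0) ↔ patF A ε t))

open scoped Classical in
/-- **THEOREM L (ii) FROM A UNIT FAMILY WITH `(W)`: every EVEN sign pattern on a CM type of `ℚ(ζₙ)` is a real
unit's.**  For `K = ℚ(ζₙ)` a CM field, a family of real units with decidable sign law `σ` (`hfam`) and the witness
property `(W)` for `σ`, every CM type `Φ` of `K` and every `S ⊆ Φ` with `|S|` even admit a unit `u` of `𝓞 K` fixed by
complex conjugation with `Re φ(u) < 0 ↔ φ ∈ S` for all `φ ∈ Φ` (the family's signed product on the pattern of the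
residues read by `S`, §1).  This is the hypothesis `hU'` of part 7's `exists_principal_of_even`.
research route conditional on HC_CM; not a corollary; Q11.4-sentence-2 already refuted in dim ≥ 3. [cite: Shimura1998, §14.3 Prop. 5, p. 104] -/
theorem exists_units_sign_eq_family [IsCMField K] [IsCyclotomicExtension {n} ℚ K] (hζ : IsPrimitiveRoot ζ n)
    (hfam : FamilyProperty) (hW : WitnessPropertyF) (Φ : CMType K) (S : Set (K →+* ℂ)) (hS : S ⊆ Φ.1) (hev : Even S.ncard) :
    ∃ u : (𝓞 K)ˣ, IsCMField.complexConj K ((u : 𝓞 K) : K) = ((u : 𝓞 K) : K) ∧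
      ∀ φ ∈ Φ.1, ((φ ((u : 𝓞 K) : K)).re < 0 ↔ φ ∈ S) := by
  classical
  set T := Finset.univ.filter fun t : ZMod n => ∃ σ ∈ Φ.1, σ ζ = 𝐞 t with hTdef
  have hT : IsCMTypeSet n T := isCMTypeSet_residueFilter hζ Φ
  set J := Finset.univ.filter fun t : ZMod n => ∃ σ ∈ S, σ ζ = 𝐞 t with hJdef
  have hJT : J ⊆ T := fun t ht => by
    obtain ⟨σ, hσ, hσt⟩ := (Finset.mem_filter.mp ht).2
    exact Finset.mem_filter.mpr ⟨Finset.mem_univ _, σ, hS hσ, hσt⟩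
  have hJcard : J.card = S.ncard := by
    rw [← Set.ncard_coe_finset]
    symm
    refine Set.ncard_congr (fun ψ _ => Classical.choose (exists_apply_eq_toCircle hζ ψ)) ?_ ?_ ?_
    · intro ψ hψ
      obtain ⟨-, hread⟩ := Classical.choose_spec (exists_apply_eq_toCircle hζ ψ)
      simp only [Finset.coe_filter, Finset.mem_univ, true_and, Set.mem_setOf_eq, hJdef]
      exact ⟨ψ, hψ, hread⟩
    · intro ψ ψ' _ _ h
      have h1 := (Classical.choose_spec (exists_apply_eq_toCircle hζ ψ)).2
      have h2 := (Classical.choose_spec (exists_apply_eq_toCircle hζ ψ')).2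
      rw [h] at h1
      exact embedding_eq_of_apply_eq hζ (h1.trans h2.symm)
    · intro t ht
      simp only [Finset.coe_filter, Finset.mem_univ, true_and, Set.mem_setOf_eq, hJdef] at ht
      obtain ⟨σ, hσS, hσt⟩ := ht
      refine ⟨σ, hσS, ?_⟩
      have h1 := (Classical.choose_spec (exists_apply_eq_toCircle hζ σ)).2
      exact ZMod.injective_toCircle (Circle.ext (h1.symm.trans hσt))
  obtain ⟨A, ε, hA, hP⟩ := exists_pattern_of_witnesses_family σ adm hW hT J hJT (hJcard ▸ hev)
  obtain ⟨u, hconj, hsign⟩ := hfam A hA ε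
  refine ⟨u, hconj, fun φ hφ => ?_⟩
  obtain ⟨t, ht, hφt⟩ := exists_apply_eq_toCircle hζ φ
  rw [hsign φ t hφt ht, hP t ht]
  have htT : t ∈ T := Finset.mem_filter.mpr ⟨Finset.mem_univ _, φ, hφ, hφt⟩
  have hnt : -t ∉ T := (hT.2 t ht).mp htT
  constructor
  · rintro (h | h)
    · obtain ⟨σ, hσS, hσt⟩ := (Finset.mem_filter.mp h).2
      rwa [embedding_eq_of_apply_eq hζ (hφt.trans hσt.symm)]
    · exact absurd (hJT h) hnt
  · intro h
    exact Or.inl (Finset.mem_filter.mpr ⟨Finset.mem_univ _, φ, h, hφt⟩)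

open scoped Classical in
/-- **THE CENSUS'S YES VERDICTS FROM A UNIT FAMILY WITH `(W)`** (kernel form, every level, every family): for
`K = ℚ(ζₙ)` a CM field with `φ(n) = 2g`, a unit family `hfam` with sign law `σ` and `(W)` for `σ`, every CM type `Φ` balanced for a CM type set `N_K`
(`2·|S_Φ ∩ N_K| = |S_Φ|`) whose `n₋ = #{t ∈ N_K : 2t < n}` is EVEN admits `ζ′ ∈ K` with `ζ′^ρ = −ζ′`,
`Im φ(ζ′) > 0` on `Φ`, and `CMTypeLattice.IsOfType 1 ζ′ ⊤`: the principal CM torus `ℂ^Φ/Φ(ℤ[ζₙ])` CARRIES an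
`ι`-compatible principal polarisation (part 7's `exists_principal_of_even` with `hU'` supplied by §2).
research route conditional on HC_CM; not a corollary; Q11.4-sentence-2 already refuted in dim ≥ 3. [cite: Shimura1998, §14.3 Prop. 5, p. 104] -/
theorem exists_principal_of_family [IsCMField K] [IsCyclotomicExtension {n} ℚ K] (hζ : IsPrimitiveRoot ζ n)
    {k : ℕ} (hg : Nat.totient n = 2 * (k + 1)) (hfam : FamilyProperty) (hW : WitnessPropertyF) (Φ : CMType K) {NK : Finset (ZMod n)}
    (hNK : IsCMTypeSet n NK)
    (hbal : 2 * ((Finset.univ.filter fun t : ZMod n => ∃ σ ∈ Φ.1, σ ζ = 𝐞 t) ∩ NK).card =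
      (Finset.univ.filter fun t : ZMod n => ∃ σ ∈ Φ.1, σ ζ = 𝐞 t).card)
    (heven : Even (NK.filter fun t : ZMod n => 2 * t.val < n).card) :
    ∃ ζ' : K, IsCMField.complexConj K ζ' = -ζ' ∧ (∀ φ : Φ.1, 0 < (φ.1 ζ').im) ∧
        CMTypeLattice.IsOfType (1 : (FractionalIdeal (𝓞 K)⁰ K)ˣ) ζ' ⊤ :=
  exists_principal_of_even hζ hg Φ hNK hbal heven fun S hS hev =>
    exists_units_sign_eq_family σ adm hζ hfam hW Φ S hS hev

end Summit.HodgeConjecture.Ring2WeilCoverage.CyclotomicUnitSignaturesFamily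

end
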